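import Summits.AtomisticToContinuum.Crystallization.Theorems.FreeSplittingCertificatesStrictSplittingRuleP1AssemblyGlue2

/-!
# `StrictSplittingRule` (stmt-AtomisticToContinuum-12560): the readout regrouping with a share table ON THE SUPPORT of the leg weights — the satisfiable form of parts 37/40/48/49/51 (P1 interpolant object, part 54)

Route `FreeSplittingCertificates`, crux r3 `StrictSplittingRule` (H12⋆ = `stub_coreJointCoercive`), unit b2b-freesplit-B gen 32.
ERRATUM + REPAIR.  `tsum_readout_leg_table_le` (part 37, gen 31) and its descendants `tsum_readout_leg_table_le_of_bounded / _p1DispSite` (part 40),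
`tsum_readout_route_le_table_p1DispSite` (part 48), `tsum_readout_leg_table_le_dyad(_p1DispSite)` (part 49), `tsum_readout_route_le_table_dyad_p1DispSite` (part 51) ask for a
share table `θ` with unit row sums for EVERY leg `e ∈ ℤ³ × ℤ³` (`hsum`) AND the carrier property (`hcar`: `θ e T ≠ 0 ⇒ e` is an edge of `T`).  For a leg that is not an edge of any
cell the two are contradictory, so those statements are VACUOUS (true, but their hypotheses cannot be met).  The certificate's table (rule v31) allocates only the legs that
actually carry weight.  This file re-proves the chain with the satisfiable hypothesis **`hsum : ∀ e, w e ≠ 0 → Σᶠ_T θ e T = 1`** (unit row sums on the support of the leg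
weights only):
* `shareTable_summable_and_tsum_eq'` — load conservation (`g e ≠ 0 → Σθ_e = 1` suffices);
* `summable_readout_cellFamily'` — the crude cell family is summable;
* **`tsum_readout_leg_table_le_dyad'`**, **`tsum_readout_leg_table_le_dyad_p1DispSite'`** — the dyad regrouping (the (T5)/(T6) interface of the assembly map);
* **`tsum_readout_route_le_table_dyad_p1DispSite'`** — bond weights → routed legs → cells (dyad form), the table normalised on the support of the routed leg weight.
NOT a proof of H12⋆, NOT summit progress.  [folklore]
-/

noncomputable section

open Set Function
open scoped BigOperators

namespace Summit.AtomisticToContinuum.Crystallization.Theorems.StrictSplittingRuleBirth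

open Literature.MathematicalPhysics.StatisticalMechanics
open Summit.AtomisticToContinuum.Crystallization.Theorems.PalmUnimodularRigidity.LayeredLawsSelectHcp

/-! ## Load conservation with unit row sums on the support of the load -/

/-- **Load conservation**, satisfiable form: a nonnegative share table with finite sections and unit row sums ON THE SUPPORT of a nonnegative summable load `g`
conserves it: `T ↦ Σᶠ_e θ e T·g e` is summable and `Σ'_T Σᶠ_e θ e T·g e = Σ'_e g e`.  NOT a proof of H12⋆, NOT summit progress. -/
theorem shareTable_summable_and_tsum_eq' {E C : Type*} (θ : E → C → ℝ) (g : E → ℝ) (hθ : ∀ e T, 0 ≤ θ e T) (hg : ∀ e, 0 ≤ g e)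
    (hfinE : ∀ e, (Function.support (θ e)).Finite) (hfinC : ∀ T, (Function.support fun e => θ e T).Finite)
    (hsum : ∀ e, g e ≠ 0 → ∑ᶠ T, θ e T = 1) (hs : Summable g) :
    Summable (fun T => ∑ᶠ e, θ e T * g e) ∧ ∑' T, ∑ᶠ e, θ e T * g e = ∑' e, g e := by
  have hfinFE : ∀ e, (Function.support fun T => θ e T * g e).Finite := fun e =>
    (hfinE e).subset fun T hT => by
      simp only [Function.mem_support, ne_eq] at hT ⊢
      exact fun h0 => hT (by rw [h0, zero_mul])
  have hfinFC : ∀ T, (Function.support fun e => θ e T * g e).Finite := fun T =>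
    (hfinC T).subset fun e he => by
      simp only [Function.mem_support, ne_eq] at he ⊢
      exact fun h0 => he (by rw [h0, zero_mul])
  have hrow : ∀ e, Summable fun T => θ e T * g e := fun e => summable_of_hasFiniteSupport (hfinFE e)
  have hcol : ∀ T, Summable fun e => θ e T * g e := fun T => summable_of_hasFiniteSupport (hfinFC T)
  have hrow_eq : ∀ e, ∑' T, θ e T * g e = g e := fun e => by
    rw [tsum_eq_finsum (hfinFE e), ← finsum_mul' _ _ (hfinE e)]
    by_cases h0 : g e = 0
    · rw [h0, mul_zero]
    · rw [hsum e h0, one_mul]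
  have hcol_eq : ∀ T, ∑' e, θ e T * g e = ∑ᶠ e, θ e T * g e := fun T => tsum_eq_finsum (hfinFC T)
  have hFs : Summable (Function.uncurry fun e T => θ e T * g e) := by
    refine (summable_prod_of_nonneg fun p => mul_nonneg (hθ _ _) (hg _)).2 ⟨hrow, ?_⟩
    exact hs.congr fun e => (hrow_eq e).symm
  have hGs : Summable (fun p : C × E => θ p.2 p.1 * g p.2) := by
    have : (fun p : C × E => θ p.2 p.1 * g p.2) = (Function.uncurry fun e T => θ e T * g e) ∘ (Equiv.prodComm C E) := by
      funext p; rfl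
    rw [this]; exact (Equiv.summable_iff _).2 hFs
  have hmargC : Summable fun T => ∑' e, θ e T * g e := hGs.prod
  refine ⟨hmargC.congr fun T => hcol_eq T, ?_⟩
  calc ∑' T, ∑ᶠ e, θ e T * g e = ∑' T, ∑' e, θ e T * g e := tsum_congr fun T => (hcol_eq T).symm
    _ = ∑' e, ∑' T, θ e T * g e := hFs.tsum_comm' hrow hcol
    _ = ∑' e, g e := tsum_congr hrow_eq

/-- **Summability of the crude cell family**, satisfiable form (row sums `= 1` only where `w ≠ 0`).  NOT a proof of H12⋆, NOT summit progress. -/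
theorem summable_readout_cellFamily' {a h : ℝ} (V : ℤ × ℤ × ℤ → (Fin 3 → ℝ))
    (w : (ℤ × ℤ × ℤ) × (ℤ × ℤ × ℤ) → ℝ) (hw : ∀ e, 0 ≤ w e)
    (θ : (ℤ × ℤ × ℤ) × (ℤ × ℤ × ℤ) → (ℤ × ℤ × ℤ) × Fin 6 → ℝ) (hθ : ∀ e T, 0 ≤ θ e T)
    (hfinE : ∀ e, (Function.support (θ e)).Finite) (hfinC : ∀ T, (Function.support fun e => θ e T).Finite)
    (hsum : ∀ e, w e ≠ 0 → ∑ᶠ T, θ e T = 1) {B : ℝ} (hB : ∀ T, fpFrob (p1CellGrad a h V T) ≤ B)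
    (hws : Summable fun e : (ℤ × ℤ × ℤ) × (ℤ × ℤ × ℤ) => w e * fpSq (fun k => hcpSite a h (e.1 + e.2) k - hcpSite a h e.1 k)) :
    Summable fun T : (ℤ × ℤ × ℤ) × Fin 6 =>
      (∑ᶠ e, θ e T * w e * fpSq (fun k => hcpSite a h (e.1 + e.2) k - hcpSite a h e.1 k)) * fpFrob (p1CellGrad a h V T) := by
  set g : (ℤ × ℤ × ℤ) × (ℤ × ℤ × ℤ) → ℝ := fun e => w e * fpSq (fun k => hcpSite a h (e.1 + e.2) k - hcpSite a h e.1 k) with hgdef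
  have hg : ∀ e, 0 ≤ g e := fun e => mul_nonneg (hw e) (fpSq_nonneg _)
  have hsum' : ∀ e, g e ≠ 0 → ∑ᶠ T, θ e T = 1 := fun e he => hsum e fun h0 => he (by rw [hgdef]; simp only [h0, zero_mul])
  obtain ⟨hload, -⟩ := shareTable_summable_and_tsum_eq' θ g hθ hg hfinE hfinC hsum' hws
  have hF0 : ∀ T, 0 ≤ fpFrob (p1CellGrad a h V T) := fun T => by unfold fpFrob; positivity
  have hB0 : 0 ≤ B := (hF0 ((0, 0, 0), 0)).trans (hB _)
  have hcell : ∀ T, ∑ᶠ e, θ e T * w e * fpSq (fun k => hcpSite a h (e.1 + e.2) k - hcpSite a h e.1 k) = ∑ᶠ e, θ e T * g e :=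
    fun T => finsum_congr fun e => by rw [hgdef, mul_assoc]
  have hload0 : ∀ T, 0 ≤ ∑ᶠ e, θ e T * g e := fun T => finsum_nonneg fun e => mul_nonneg (hθ e T) (hg e)
  refine Summable.of_nonneg_of_le (fun T => ?_) (fun T => ?_) (hload.mul_right B)
  · rw [hcell]; exact mul_nonneg (hload0 T) (hF0 T)
  · rw [hcell]; exact mul_le_mul_of_nonneg_left (hB T) (hload0 T)

/-! ## The dyad regrouping, satisfiable form -/

/-- **THE READOUT REGROUPING OVER AN ALLOCATION TABLE, DYAD FORM, satisfiable hypotheses**: nonnegative leg weights with summable loads, a nonnegative share table with finite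
sections, unit row sums ON THE SUPPORT of `w` and the carrier property, lattice values with bounded cell gradients.  Then the dyad cell family is summable and
`Σ'_e w_e·|V(q+s) − V q|² ≤ Σ'_T Σᶠ_e θ_{eT}·w_e·|d_eᵀ G_T|²`.  NOT a proof of H12⋆, NOT summit progress. -/
theorem tsum_readout_leg_table_le_dyad' {a h : ℝ} (ha : a ≠ 0) (hh : h ≠ 0) (V : ℤ × ℤ × ℤ → (Fin 3 → ℝ))
    (w : (ℤ × ℤ × ℤ) × (ℤ × ℤ × ℤ) → ℝ) (hw : ∀ e, 0 ≤ w e)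
    (θ : (ℤ × ℤ × ℤ) × (ℤ × ℤ × ℤ) → (ℤ × ℤ × ℤ) × Fin 6 → ℝ) (hθ : ∀ e T, 0 ≤ θ e T)
    (hfinE : ∀ e, (Function.support (θ e)).Finite) (hfinC : ∀ T, (Function.support fun e => θ e T).Finite)
    (hsum : ∀ e, w e ≠ 0 → ∑ᶠ T, θ e T = 1)
    (hcar : ∀ e T, θ e T ≠ 0 → ∃ m m' : Fin 4, e.1 = T.1 + p1VertOff (p1Par T.1) T.2 m ∧
      e.1 + e.2 = T.1 + p1VertOff (p1Par T.1) T.2 m')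
    {B : ℝ} (hB : ∀ T, fpFrob (p1CellGrad a h V T) ≤ B)
    (hws : Summable fun e : (ℤ × ℤ × ℤ) × (ℤ × ℤ × ℤ) => w e * fpSq (fun k => hcpSite a h (e.1 + e.2) k - hcpSite a h e.1 k)) :
    Summable (fun T : (ℤ × ℤ × ℤ) × Fin 6 => ∑ᶠ e : (ℤ × ℤ × ℤ) × (ℤ × ℤ × ℤ), θ e T * w e *
      fpSq (fun k => (hcpSite a h (e.1 + e.2) 0 - hcpSite a h e.1 0) * p1CellGrad a h V T 0 k +
        (hcpSite a h (e.1 + e.2) 1 - hcpSite a h e.1 1) * p1CellGrad a h V T 1 k +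
        (hcpSite a h (e.1 + e.2) 2 - hcpSite a h e.1 2) * p1CellGrad a h V T 2 k)) ∧
    Summable (fun e : (ℤ × ℤ × ℤ) × (ℤ × ℤ × ℤ) => w e * fpSq (fun k => V (e.1 + e.2) k - V e.1 k)) ∧
    ∑' e : (ℤ × ℤ × ℤ) × (ℤ × ℤ × ℤ), w e * fpSq (fun k => V (e.1 + e.2) k - V e.1 k) ≤
    ∑' T : (ℤ × ℤ × ℤ) × Fin 6, ∑ᶠ e : (ℤ × ℤ × ℤ) × (ℤ × ℤ × ℤ), θ e T * w e *
      fpSq (fun k => (hcpSite a h (e.1 + e.2) 0 - hcpSite a h e.1 0) * p1CellGrad a h V T 0 k +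
        (hcpSite a h (e.1 + e.2) 1 - hcpSite a h e.1 1) * p1CellGrad a h V T 1 k +
        (hcpSite a h (e.1 + e.2) 2 - hcpSite a h e.1 2) * p1CellGrad a h V T 2 k) := by
  set D : (ℤ × ℤ × ℤ) × (ℤ × ℤ × ℤ) → (ℤ × ℤ × ℤ) × Fin 6 → ℝ := fun e T =>
    fpSq (fun k => (hcpSite a h (e.1 + e.2) 0 - hcpSite a h e.1 0) * p1CellGrad a h V T 0 k +
      (hcpSite a h (e.1 + e.2) 1 - hcpSite a h e.1 1) * p1CellGrad a h V T 1 k +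
      (hcpSite a h (e.1 + e.2) 2 - hcpSite a h e.1 2) * p1CellGrad a h V T 2 k) with hDdef
  set F : (ℤ × ℤ × ℤ) × (ℤ × ℤ × ℤ) → (ℤ × ℤ × ℤ) × Fin 6 → ℝ := fun e T => θ e T * w e * D e T with hFdef
  have hD0 : ∀ e T, 0 ≤ D e T := fun e T => fpSq_nonneg _
  have hDle : ∀ e T, D e T ≤ fpSq (fun k => hcpSite a h (e.1 + e.2) k - hcpSite a h e.1 k) * fpFrob (p1CellGrad a h V T) := fun e T =>
    fpSq_vecMul_le (fun k => hcpSite a h (e.1 + e.2) k - hcpSite a h e.1 k) (p1CellGrad a h V T)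
  have hF0 : ∀ e T, 0 ≤ F e T := fun e T => mul_nonneg (mul_nonneg (hθ e T) (hw e)) (hD0 e T)
  have hsuppE : ∀ e, Function.support (F e) ⊆ Function.support (θ e) := fun e T hT => by
    simp only [Function.mem_support, ne_eq] at hT ⊢
    exact fun h0 => hT (by simp only [hFdef, h0, zero_mul])
  have hsuppC : ∀ T, (Function.support fun e => F e T) ⊆ Function.support fun e => θ e T := fun T e he => by
    simp only [Function.mem_support, ne_eq] at he ⊢
    exact fun h0 => he (by simp only [hFdef, h0, zero_mul])
  have hfinFE : ∀ e, (Function.support (F e)).Finite := fun e => (hfinE e).subset (hsuppE e)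
  have hfinFC : ∀ T, (Function.support fun e => F e T).Finite := fun T => (hfinC T).subset (hsuppC T)
  -- termwise: w e R e ≤ Σᶠ_T F e T  (equality on the support of w; 0 ≤ Σᶠ F off it)
  have hle : ∀ e, w e * fpSq (fun k => V (e.1 + e.2) k - V e.1 k) ≤ ∑ᶠ T, F e T := by
    intro e
    by_cases hwe : w e = 0
    · rw [hwe, zero_mul]
      exact finsum_nonneg fun T => hF0 e T
    have hterm : ∀ T, θ e T * (w e * fpSq (fun k => V (e.1 + e.2) k - V e.1 k)) = F e T := by
      intro T
      by_cases h0 : θ e T = 0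
      · simp only [hFdef, h0, zero_mul]
      · obtain ⟨m, m', hm, hm'⟩ := hcar e T h0
        rw [hFdef, fpSq_readout_eq_dyad ha hh V T hm hm']
        ring
    calc w e * fpSq (fun k => V (e.1 + e.2) k - V e.1 k)
        = (∑ᶠ T, θ e T) * (w e * fpSq (fun k => V (e.1 + e.2) k - V e.1 k)) := by rw [hsum e hwe, one_mul]
      _ = ∑ᶠ T, θ e T * (w e * fpSq (fun k => V (e.1 + e.2) k - V e.1 k)) := finsum_mul' _ _ (hfinE e)
      _ = ∑ᶠ T, F e T := finsum_congr hterm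
      _ ≤ ∑ᶠ T, F e T := le_rfl
  have hcrude := summable_readout_cellFamily' V w hw θ hθ hfinE hfinC hsum hB hws
  have hcell_le : ∀ T, ∑ᶠ e, F e T ≤
      (∑ᶠ e, θ e T * w e * fpSq (fun k => hcpSite a h (e.1 + e.2) k - hcpSite a h e.1 k)) * fpFrob (p1CellGrad a h V T) := by
    intro T
    have hfin1 : (Function.support fun e => θ e T * w e * fpSq (fun k => hcpSite a h (e.1 + e.2) k - hcpSite a h e.1 k)).Finite :=
      (hfinC T).subset fun e he => by
        simp only [Function.mem_support, ne_eq] at he ⊢; exact fun h0 => he (by simp only [h0, zero_mul])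
    have hfin2 : (Function.support fun e => θ e T * w e * fpSq (fun k => hcpSite a h (e.1 + e.2) k - hcpSite a h e.1 k) *
        fpFrob (p1CellGrad a h V T)).Finite :=
      (hfinC T).subset fun e he => by
        simp only [Function.mem_support, ne_eq] at he ⊢; exact fun h0 => he (by simp only [h0, zero_mul])
    rw [finsum_mul' _ _ hfin1]
    refine finsum_le_finsum' (hfinFC T) hfin2 fun e => ?_
    calc F e T = θ e T * w e * D e T := rfl
      _ ≤ θ e T * w e * (fpSq (fun k => hcpSite a h (e.1 + e.2) k - hcpSite a h e.1 k) * fpFrob (p1CellGrad a h V T)) :=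
          mul_le_mul_of_nonneg_left (hDle e T) (mul_nonneg (hθ e T) (hw e))
      _ = θ e T * w e * fpSq (fun k => hcpSite a h (e.1 + e.2) k - hcpSite a h e.1 k) * fpFrob (p1CellGrad a h V T) := by ring
  have hcell0 : ∀ T, 0 ≤ ∑ᶠ e, F e T := fun T => finsum_nonneg fun e => hF0 e T
  have hs : Summable fun T => ∑ᶠ e, F e T := Summable.of_nonneg_of_le hcell0 hcell_le hcrude
  have hA0 : ∀ e : (ℤ × ℤ × ℤ) × (ℤ × ℤ × ℤ), 0 ≤ w e * fpSq (fun k => V (e.1 + e.2) k - V e.1 k) := fun e => mul_nonneg (hw e) (fpSq_nonneg _)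
  obtain ⟨hsA, hineq⟩ := tsum_le_tsum_regroup _ F hA0 hF0 hfinFE hfinFC hle hs
  exact ⟨hs, hsA, hineq⟩

/-- **The dyad regrouping for the far-ledger field**, satisfiable hypotheses (`V = p1DispSite a h U b₀ A`, `G_T = G_T(U) − A`).  NOT a proof of H12⋆, NOT summit progress. -/
theorem tsum_readout_leg_table_le_dyad_p1DispSite' {a h : ℝ} (ha : 0 < a) (hh : 0 < h) (U : ℤ × ℤ × ℤ → (Fin 3 → ℝ))
    (hU : (support U).Finite) (b₀ : Fin 3 → ℝ) (A : Fin 3 → Fin 3 → ℝ)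
    (w : (ℤ × ℤ × ℤ) × (ℤ × ℤ × ℤ) → ℝ) (hw : ∀ e, 0 ≤ w e)
    (θ : (ℤ × ℤ × ℤ) × (ℤ × ℤ × ℤ) → (ℤ × ℤ × ℤ) × Fin 6 → ℝ) (hθ : ∀ e T, 0 ≤ θ e T)
    (hfinE : ∀ e, (Function.support (θ e)).Finite) (hfinC : ∀ T, (Function.support fun e => θ e T).Finite)
    (hsum : ∀ e, w e ≠ 0 → ∑ᶠ T, θ e T = 1)
    (hcar : ∀ e T, θ e T ≠ 0 → ∃ m m' : Fin 4, e.1 = T.1 + p1VertOff (p1Par T.1) T.2 m ∧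
      e.1 + e.2 = T.1 + p1VertOff (p1Par T.1) T.2 m')
    (hws : Summable fun e : (ℤ × ℤ × ℤ) × (ℤ × ℤ × ℤ) => w e * fpSq (fun k => hcpSite a h (e.1 + e.2) k - hcpSite a h e.1 k)) :
    Summable (fun T : (ℤ × ℤ × ℤ) × Fin 6 => ∑ᶠ e : (ℤ × ℤ × ℤ) × (ℤ × ℤ × ℤ), θ e T * w e *
      fpSq (fun k => (hcpSite a h (e.1 + e.2) 0 - hcpSite a h e.1 0) * (p1CellGrad a h U T 0 k - A 0 k) +
        (hcpSite a h (e.1 + e.2) 1 - hcpSite a h e.1 1) * (p1CellGrad a h U T 1 k - A 1 k) +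
        (hcpSite a h (e.1 + e.2) 2 - hcpSite a h e.1 2) * (p1CellGrad a h U T 2 k - A 2 k))) ∧
    Summable (fun e : (ℤ × ℤ × ℤ) × (ℤ × ℤ × ℤ) =>
      w e * fpSq (fun k => p1DispSite a h U b₀ A (e.1 + e.2) k - p1DispSite a h U b₀ A e.1 k)) ∧
    ∑' e : (ℤ × ℤ × ℤ) × (ℤ × ℤ × ℤ), w e * fpSq (fun k => p1DispSite a h U b₀ A (e.1 + e.2) k - p1DispSite a h U b₀ A e.1 k) ≤
    ∑' T : (ℤ × ℤ × ℤ) × Fin 6, ∑ᶠ e : (ℤ × ℤ × ℤ) × (ℤ × ℤ × ℤ), θ e T * w e *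
      fpSq (fun k => (hcpSite a h (e.1 + e.2) 0 - hcpSite a h e.1 0) * (p1CellGrad a h U T 0 k - A 0 k) +
        (hcpSite a h (e.1 + e.2) 1 - hcpSite a h e.1 1) * (p1CellGrad a h U T 1 k - A 1 k) +
        (hcpSite a h (e.1 + e.2) 2 - hcpSite a h e.1 2) * (p1CellGrad a h U T 2 k - A 2 k)) := by
  obtain ⟨B, hB⟩ := exists_bound_fpFrob_p1CellGrad_p1DispSite ha hh U hU b₀ A
  have hmain := tsum_readout_leg_table_le_dyad' ha.ne' hh.ne' (fun n k => p1DispSite a h U b₀ A n k) w hw θ hθ hfinE hfinC hsum hcar hB hws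
  simp only [p1CellGrad_p1DispSite ha hh] at hmain
  exact hmain

/-- **THE ROUTED READOUT OVER AN ALLOCATION TABLE, DYAD FORM, far-ledger field, satisfiable hypotheses** (unit row sums of `θv` on the support of the routed leg weight `w'`).
NOT a proof of H12⋆, NOT summit progress. -/
theorem tsum_readout_route_le_table_dyad_p1DispSite' {a h : ℝ} (ha : 0 < a) (hh : 0 < h) (U : ℤ × ℤ × ℤ → (Fin 3 → ℝ))
    (hU : (support U).Finite) (b₀ : Fin 3 → ℝ) (A : Fin 3 → Fin 3 → ℝ) (s : ℤ × ℤ × ℤ)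
    (o : (ℤ × ℤ × ℤ) → Fin 3 → ℤ × ℤ × ℤ) (S : Finset (ℤ × ℤ × ℤ)) (ho : ∀ q i, o q i ∈ S)
    (wv : ℤ × ℤ × ℤ → ℝ) (hwv : ∀ q, 0 ≤ wv q) (hwvs : Summable wv)
    (θ : (ℤ × ℤ × ℤ) × (ℤ × ℤ × ℤ) → (ℤ × ℤ × ℤ) × Fin 6 → ℝ) (hθ : ∀ e T, 0 ≤ θ e T)
    (hfinE : ∀ e, (Function.support (θ e)).Finite) (hfinC : ∀ T, (Function.support fun e => θ e T).Finite)
    (hsum : ∀ e, (∑ i : Fin 3, (2 / 3) * ((if e.2 = o e.1 i then wv e.1 else 0) +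
        (if o (e.1 - (s - e.2)) i = s - e.2 then wv (e.1 - (s - e.2)) else 0))) ≠ 0 → ∑ᶠ T, θ e T = 1)
    (hcar : ∀ e T, θ e T ≠ 0 → ∃ m m' : Fin 4, e.1 = T.1 + p1VertOff (p1Par T.1) T.2 m ∧
      e.1 + e.2 = T.1 + p1VertOff (p1Par T.1) T.2 m') :
    Summable (fun T : (ℤ × ℤ × ℤ) × Fin 6 => ∑ᶠ e : (ℤ × ℤ × ℤ) × (ℤ × ℤ × ℤ), θ e T *
      (∑ i : Fin 3, (2 / 3) * ((if e.2 = o e.1 i then wv e.1 else 0) +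
        (if o (e.1 - (s - e.2)) i = s - e.2 then wv (e.1 - (s - e.2)) else 0))) *
      fpSq (fun k => (hcpSite a h (e.1 + e.2) 0 - hcpSite a h e.1 0) * (p1CellGrad a h U T 0 k - A 0 k) +
        (hcpSite a h (e.1 + e.2) 1 - hcpSite a h e.1 1) * (p1CellGrad a h U T 1 k - A 1 k) +
        (hcpSite a h (e.1 + e.2) 2 - hcpSite a h e.1 2) * (p1CellGrad a h U T 2 k - A 2 k))) ∧
    ∑' q : ℤ × ℤ × ℤ, wv q * fpSq (fun k => p1DispSite a h U b₀ A (q + s) k - p1DispSite a h U b₀ A q k) ≤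
    ∑' T : (ℤ × ℤ × ℤ) × Fin 6, ∑ᶠ e : (ℤ × ℤ × ℤ) × (ℤ × ℤ × ℤ), θ e T *
      (∑ i : Fin 3, (2 / 3) * ((if e.2 = o e.1 i then wv e.1 else 0) +
        (if o (e.1 - (s - e.2)) i = s - e.2 then wv (e.1 - (s - e.2)) else 0))) *
      fpSq (fun k => (hcpSite a h (e.1 + e.2) 0 - hcpSite a h e.1 0) * (p1CellGrad a h U T 0 k - A 0 k) +
        (hcpSite a h (e.1 + e.2) 1 - hcpSite a h e.1 1) * (p1CellGrad a h U T 1 k - A 1 k) +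
        (hcpSite a h (e.1 + e.2) 2 - hcpSite a h e.1 2) * (p1CellGrad a h U T 2 k - A 2 k)) := by
  obtain ⟨_, _, hle1⟩ := tsum_readout_route_le_legs_p1DispSite ha hh U hU b₀ A s o S ho wv hwv hwvs
  obtain ⟨_, heq⟩ := tsum_routeWeight_readout_eq ha hh U hU b₀ A s o S ho wv hwv hwvs
  obtain ⟨hsD, _, hle2⟩ := tsum_readout_leg_table_le_dyad_p1DispSite' ha hh U hU b₀ A _ (routeWeight_nonneg s o wv hwv) θ hθ hfinE hfinC
    hsum hcar (summable_routeWeight_load a h s o S ho wv hwv hwvs)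
  refine ⟨hsD, hle1.trans ?_⟩
  rw [← heq]
  exact hle2

end Summit.AtomisticToContinuum.Crystallization.Theorems.StrictSplittingRuleBirth

end
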